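import Summits.AtomisticToContinuum.HydrodynamicLimit.Theorems.CollisionIsometryCLTMacroClosureTwoScaleDefs
import Summits.AtomisticToContinuum.HydrodynamicLimit.Theorems.CollisionIsometryCLTMacroClosureTwoScaleJensenPoint
import Summits.AtomisticToContinuum.HydrodynamicLimit.Theorems.CollisionIsometryCLTMacroClosureStubThermoEos
import Summits.AtomisticToContinuum.HydrodynamicLimit.Theses.StiffCollisionalRelaxation
import Mathlib.Analysis.Convex.Deriv
import HarnessLib

/-!
# The configurational and kinetic rates of a box block (input of `stub_blockMGF_twoScale`,
line `IdeatorTwoGen1Sketch`, crux `MacroClosure`, stmt-AtomisticToContinuum-14870)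

Proof file (`--supports stmt-AtomisticToContinuum-14870`) for the registered stub `Barycentric.stub_twoScale_rates`.

With `(η₀, F)` the `HsEosLowDensity` data (`eos_data`) and `σ < σ₁ := min 1 η₀` (so `σ³ < η₀` and
`σ³ < 11/10`):

* (a) the configurational Bregman density `confRate σ u_c θ_c r = h_σ(stateOf r u_c θ_c | stateOf 1 u_c θ_c)`
  is `r log r − r + 1 +` the Bregman divergence at `1` of `r ↦ r f_ex(rσ³)` (`relEnt_stateOf` at
  `ρ = 1`: the thermal and the kinetic parts vanish);
* (b) under `HsFreeEnergyConvex` it is non-negative on the band `0 < r`, `rσ³ < 11/10`: the path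
  `r ↦ stateOf r u_c θ_c = r • stateOf 1 u_c θ_c` is linear, so `confRate` is convex on the band
  (`JensenPoint.convexOn_relEnt` composed with a linear map), vanishes at `r = 1` and is flat there
  (chain rule), whence it lies above its (zero) tangent (`ConvexOn.le_slope_of_hasDerivAt`,
  `ConvexOn.slope_le_of_hasDerivAt`);
* (c) for a cube carrying two particles with distinct velocities, the box block state is
  `stateOf ρ̄ ū θ̄` with `ρ̄ = n/((N+1)ℓ³)`, `ū = (Σ_S vᵢ)/n`, `θ̄ = SS/(3n) > 0`
  (`JensenPoint.bU_boxKernel`, `Clausius.stateTemp_bU_pos`), and `relEnt_stateOf` splits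
  `(N+1)ℓ³ h_σ(Ū | U_c)` into `(N+1)ℓ³ confRate σ u_c θ_c ρ̄` plus the kinetic rate `cellKin ≥ 0`
  (`x − 1 − log x ≥ 0`).
-/

noncomputable section

open MeasureTheory Filter Set Topology InformationTheory
open scoped ENNReal ContDiff Convolution

namespace Summit.AtomisticToContinuum.HydrodynamicLimit.Theorems.MacroClosureLine

open Literature.MathematicalPhysics.KineticTheory Literature.Analysis.FluidPDE
open Literature.Analysis.FunctionSpaces
open Summit.AtomisticToContinuum.HydrodynamicLimit.Theses

namespace Barycentric

namespace TwoScaleRates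

variable {η₀ : ℝ} {F : ℝ → ℝ}

/-! ## The linear path `r ↦ stateOf r u θ` and the configurational rate -/

/-- The primitive-variable path at fixed `(u, θ)` is linear: `stateOf r u θ = r • stateOf 1 u θ`.
[folklore] -/
theorem stateOf_eq_smul (r : ℝ) (u : V3) (θ : ℝ) : stateOf r u θ = r • stateOf 1 u θ := by
  refine Prod.ext ?_ (Prod.ext ?_ ?_)
  · simp [stateOf]
  · simp [stateOf]
  · simp [stateOf, totalEnergyDensity]

/-- `h_σ(U | U) = 0`. [folklore] -/
theorem relEnt_self (σ : ℝ) (U : State) : relEnt σ U U = 0 := by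
  simp [relEnt]

/-- **Part (a)**: the explicit configurational rate
`confRate σ u_c θ_c r = r log r − r + 1 + (r f(rσ³) − f(σ³) − (f(σ³) + σ³ f′(σ³))(r − 1))`, `r ≠ 0`,
`σ³ < η₀`. [folklore] -/
theorem confRate_eq (hFa : AnalyticOnNhd ℝ F (Ioo (-η₀) η₀))
    (hF : EqOn hsExcessFreeEnergy F (Ico 0 η₀)) {σ : ℝ} (hσ : 0 < σ) (hx : σ ^ 3 < η₀) (uc : V3)
    {θc : ℝ} (hθc : 0 < θc) {r : ℝ} (hr : r ≠ 0) :
    confRate σ uc θc r = r * Real.log r - r + 1 +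
      (r * hsExcessFreeEnergy (r * σ ^ 3) - hsExcessFreeEnergy (σ ^ 3) -
        (hsExcessFreeEnergy (σ ^ 3) + σ ^ 3 * deriv hsExcessFreeEnergy (σ ^ 3)) * (r - 1)) := by
  have hx1 : (1 : ℝ) * σ ^ 3 < η₀ := by rwa [one_mul]
  rw [confRate, relEnt_stateOf hFa hF uc hσ one_pos hθc hx1 hr uc θc, Real.log_one, div_self hθc.ne',
    sub_self uc, norm_zero]
  simp only [one_mul]
  ring

/-- Convexity of the configurational rate on the band `(0, (11/10)/σ³)` under `HsFreeEnergyConvex`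
(`h_σ(· | U_c)` is convex on the convexity domain and the path `r ↦ r • U_c` is linear). [folklore] -/
theorem convexOn_confRate (hH : StiffCollisionalRelaxation.HsFreeEnergyConvex) {σ : ℝ} (hσ : 0 < σ)
    (uc : V3) {θc : ℝ} (hθc : 0 < θc) :
    ConvexOn ℝ (Ioo (0 : ℝ) (11 / 10 / σ ^ 3)) (confRate σ uc θc) := by
  have h := (JensenPoint.convexOn_relEnt hH hσ (stateOf 1 uc θc)).comp_linearMap
    (LinearMap.toSpanSingleton ℝ State (stateOf 1 uc θc))
  have hσ3 : 0 < σ ^ 3 := by positivity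
  refine (h.subset ?_ (convex_Ioo _ _)).congr ?_
  · intro r hr
    have hr' : r * σ ^ 3 < 11 / 10 := (lt_div_iff₀ hσ3).1 hr.2
    rw [Set.mem_preimage, LinearMap.toSpanSingleton_apply, ← stateOf_eq_smul]
    exact stateOf_mem_chamber uc hr.1 hθc hr'
  · intro r _
    show relEnt σ (LinearMap.toSpanSingleton ℝ State (stateOf 1 uc θc) r) (stateOf 1 uc θc) =
      confRate σ uc θc r
    rw [LinearMap.toSpanSingleton_apply, ← stateOf_eq_smul]
    rfl

/-- The configurational rate is flat at `r = 1`: by the chain rule both `r ↦ η_σ(r • U_c)` and the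
affine correction `r ↦ Dη_σ(U_c)(r • U_c − U_c)` have derivative `Dη_σ(U_c) U_c` at `r = 1`. [folklore] -/
theorem hasDerivAt_confRate (hFa : AnalyticOnNhd ℝ F (Ioo (-η₀) η₀))
    (hF : EqOn hsExcessFreeEnergy F (Ico 0 η₀)) {σ : ℝ} (hσ : 0 < σ) (hx : σ ^ 3 < η₀) (uc : V3)
    {θc : ℝ} (hθc : 0 < θc) : HasDerivAt (confRate σ uc θc) 0 1 := by
  have hx1 : (1 : ℝ) * σ ^ 3 < η₀ := by rwa [one_mul]
  have hd : DifferentiableAt ℝ (hsEntropy σ) (stateOf 1 uc θc) :=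
    differentiableAt_hsEntropy hFa hF hσ (stateOf_mem_chamber uc one_pos hθc hx1)
  have hL : HasDerivAt (fun r : ℝ => r • stateOf 1 uc θc) (stateOf 1 uc θc) 1 := by
    simpa using (hasDerivAt_id (1 : ℝ)).smul_const (stateOf 1 uc θc)
  have h1 : HasDerivAt (fun r : ℝ => hsEntropy σ (r • stateOf 1 uc θc))
      (fderiv ℝ (hsEntropy σ) (stateOf 1 uc θc) (stateOf 1 uc θc)) 1 :=
    hd.hasFDerivAt.comp_hasDerivAt_of_eq 1 hL (by simp)
  have h2 : HasDerivAt (fun r : ℝ => fderiv ℝ (hsEntropy σ) (stateOf 1 uc θc)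
      (r • stateOf 1 uc θc - stateOf 1 uc θc))
      (fderiv ℝ (hsEntropy σ) (stateOf 1 uc θc) (stateOf 1 uc θc)) 1 :=
    (fderiv ℝ (hsEntropy σ) (stateOf 1 uc θc)).hasFDerivAt.comp_hasDerivAt 1
      (hL.sub_const (stateOf 1 uc θc))
  have hfun : confRate σ uc θc = fun r => hsEntropy σ (r • stateOf 1 uc θc) -
      hsEntropy σ (stateOf 1 uc θc) -
      fderiv ℝ (hsEntropy σ) (stateOf 1 uc θc) (r • stateOf 1 uc θc - stateOf 1 uc θc) := by
    funext r
    rw [confRate, relEnt, stateOf_eq_smul r uc θc]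
  rw [hfun]
  have h := (h1.sub_const (hsEntropy σ (stateOf 1 uc θc))).fun_sub h2
  rwa [sub_self] at h

/-- **Part (b)**: under `HsFreeEnergyConvex` the configurational rate is non-negative on the band
`0 < r`, `rσ³ < 11/10` (`σ < 1`, `σ³ < η₀`): a convex function lies above its tangent at `r = 1`,
which is zero. [folklore] -/
theorem confRate_nonneg (hFa : AnalyticOnNhd ℝ F (Ioo (-η₀) η₀))
    (hF : EqOn hsExcessFreeEnergy F (Ico 0 η₀)) (hH : StiffCollisionalRelaxation.HsFreeEnergyConvex)
    {σ : ℝ} (hσ : 0 < σ) (hσ1 : σ < 1) (hx : σ ^ 3 < η₀) (uc : V3) {θc : ℝ} (hθc : 0 < θc) {r : ℝ}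
    (hr : 0 < r) (hrσ : r * σ ^ 3 < 11 / 10) : 0 ≤ confRate σ uc θc r := by
  have hconv := convexOn_confRate hH hσ uc hθc
  have hder := hasDerivAt_confRate hFa hF hσ hx uc hθc
  have h1 : confRate σ uc θc 1 = 0 := relEnt_self σ _
  have hσ3 : 0 < σ ^ 3 := by positivity
  have h1I : (1 : ℝ) ∈ Ioo (0 : ℝ) (11 / 10 / σ ^ 3) := by
    refine ⟨one_pos, (lt_div_iff₀ hσ3).2 ?_⟩
    have : σ ^ 3 < 1 := pow_lt_one₀ hσ.le hσ1 three_ne_zero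
    linarith
  have hrI : r ∈ Ioo (0 : ℝ) (11 / 10 / σ ^ 3) := ⟨hr, (lt_div_iff₀ hσ3).2 hrσ⟩
  rcases lt_trichotomy r 1 with hlt | rfl | hgt
  · have h := hconv.slope_le_of_hasDerivAt hrI h1I hlt hder
    rw [slope_def_field, h1, div_le_iff₀ (sub_pos.2 hlt)] at h
    linarith
  · exact h1.ge
  · have h := hconv.le_slope_of_hasDerivAt h1I hrI hgt hder
    rw [slope_def_field, h1, le_div_iff₀ (sub_pos.2 hgt)] at h
    linarith

/-! ## The box block in primitive variables and the kinetic rate -/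

variable {N : ℕ}

/-- The box block state in primitive variables: `Ū_b(z, y) = stateOf ρ̄ ū θ̄` with
`ρ̄ = n/((N+1)ℓ³)`, `ū = (Σ_S vᵢ)/n`, `θ̄ = (Σ_S ‖vᵢ‖² − ‖Σ_S vᵢ‖²/n)/(3n)` (`n = #S ≠ 0`). [folklore] -/
theorem bU_boxKernel_eq_stateOf (ℓ : ℝ) (z : Config (N + 1) (Fin 3) T3) (y : T3) (hℓ : ℓ ≠ 0)
    (hn : (cellCount ℓ z y : ℝ) ≠ 0) :
    bU (boxKernel ℓ) z y =
      stateOf ((cellCount ℓ z y : ℝ) / (((N : ℝ) + 1) * ℓ ^ 3))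
        ((cellCount ℓ z y : ℝ)⁻¹ • ∑ i ∈ cellSet ℓ z y, (z i).2)
        (((∑ i ∈ cellSet ℓ z y, ‖(z i).2‖ ^ 2) -
            ‖∑ i ∈ cellSet ℓ z y, (z i).2‖ ^ 2 / (cellCount ℓ z y : ℝ)) /
          (3 * (cellCount ℓ z y : ℝ))) := by
  have hN : ((N : ℝ) + 1) ≠ 0 := by positivity
  have hℓ3 : ℓ ^ 3 ≠ 0 := pow_ne_zero 3 hℓ
  rw [JensenPoint.bU_boxKernel]
  refine Prod.ext ?_ (Prod.ext ?_ ?_)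
  · simp only [Prod.smul_fst, Prod.fst_sum, Prod.smul_mk, smul_eq_mul, mul_one, Finset.sum_const,
      nsmul_eq_mul, stateOf_fst, cellCount]
    push_cast
    field_simp
  · simp only [Prod.smul_snd, Prod.smul_fst, Prod.snd_sum, Prod.fst_sum, Prod.smul_mk,
      stateOf_snd_fst, ← Finset.smul_sum, smul_smul]
    congr 1
    push_cast
    field_simp
  · simp only [Prod.smul_snd, Prod.snd_sum, Prod.smul_mk, smul_eq_mul, stateOf_snd_snd,
      ← Finset.mul_sum, ← Finset.sum_div, norm_smul, norm_inv, Real.norm_natCast]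
    push_cast
    field_simp
    ring

/-- The kinetic rate in primitive variables: with `SS = Q − ‖M‖²/n`, `θ̄ = SS/(3n) > 0`, `ū = M/n`,
`(SS + ‖M − n u_c‖²/n)/(2θ_c) − (3n/2)(1 + log(SS/(3nθ_c))) = (3/2) n (θ̄/θ_c − 1 − log(θ̄/θ_c)) + n‖ū − u_c‖²/(2θ_c)`.
[folklore] -/
theorem kin_identity (n Q : ℝ) (M uc : V3) (θc : ℝ) (hn : 0 < n) (hθc : 0 < θc)
    (hθ : 0 < (Q - ‖M‖ ^ 2 / n) / (3 * n)) :
    ((Q - ‖M‖ ^ 2 / n) + ‖M - n • uc‖ ^ 2 / n) / (2 * θc) -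
        3 * n / 2 * (1 + Real.log ((Q - ‖M‖ ^ 2 / n) / (3 * n * θc))) =
      3 / 2 * n * ((Q - ‖M‖ ^ 2 / n) / (3 * n) / θc - 1 -
          (Real.log ((Q - ‖M‖ ^ 2 / n) / (3 * n)) - Real.log θc)) +
        n * ‖n⁻¹ • M - uc‖ ^ 2 / (2 * θc) := by
  have hlog : Real.log ((Q - ‖M‖ ^ 2 / n) / (3 * n * θc)) =
      Real.log ((Q - ‖M‖ ^ 2 / n) / (3 * n)) - Real.log θc := by
    rw [← Real.log_div hθ.ne' hθc.ne', div_div]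
  have hnorm : ‖n⁻¹ • M - uc‖ = n⁻¹ * ‖M - n • uc‖ := by
    rw [show n⁻¹ • M - uc = n⁻¹ • (M - n • uc) by
      rw [smul_sub, smul_smul, inv_mul_cancel₀ hn.ne', one_smul], norm_smul, Real.norm_eq_abs,
      abs_of_pos (inv_pos.2 hn)]
  rw [hlog, hnorm]
  generalize Real.log ((Q - ‖M‖ ^ 2 / n) / (3 * n)) = L
  field_simp
  ring

/-- Non-negativity of the kinetic rate: `x − 1 − log x ≥ 0` and squares are non-negative. [folklore] -/
theorem kin_nonneg {n θ θc : ℝ} (w : V3) (hn : 0 < n) (hθ : 0 < θ) (hθc : 0 < θc) :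
    0 ≤ 3 / 2 * n * (θ / θc - 1 - (Real.log θ - Real.log θc)) + n * ‖w‖ ^ 2 / (2 * θc) := by
  have h1 : 0 ≤ θ / θc - 1 - (Real.log θ - Real.log θc) := by
    rw [← Real.log_div hθ.ne' hθc.ne']
    linarith [Real.log_le_sub_one_of_pos (div_pos hθ hθc)]
  exact add_nonneg (mul_nonneg (by positivity) h1) (by positivity)

end TwoScaleRates

open TwoScaleRates in
/-- **The two rates of a box block** (registered stub `stub_twoScale_rates`). [folklore] -/
theorem stub_twoScale_rates : ∃ σ₁ : ℝ, 0 < σ₁ ∧ ∀ σ : ℝ, 0 < σ → σ < σ₁ → ∀ (uc : V3) (θc : ℝ), 0 < θc →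
    (∀ r : ℝ, r ≠ 0 → confRate σ uc θc r = r * Real.log r - r + 1 +
      (r * hsExcessFreeEnergy (r * σ ^ 3) - hsExcessFreeEnergy (σ ^ 3) -
        (hsExcessFreeEnergy (σ ^ 3) + σ ^ 3 * deriv hsExcessFreeEnergy (σ ^ 3)) * (r - 1))) ∧
    (StiffCollisionalRelaxation.HsFreeEnergyConvex → ∀ r : ℝ, 0 < r → r * σ ^ 3 < 11 / 10 → 0 ≤ confRate σ uc θc r) ∧
    (∀ (N : ℕ) (ℓ : ℝ), 0 < ℓ → ∀ (z : Config (N + 1) (Fin 3) T3) (y : T3),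
      (∃ i ∈ cellSet ℓ z y, ∃ j ∈ cellSet ℓ z y, (z i).2 ≠ (z j).2) →
      ((N : ℝ) + 1) * ℓ ^ 3 * relEnt σ (bU (boxKernel ℓ) z y) (stateOf 1 uc θc) =
        ((N : ℝ) + 1) * ℓ ^ 3 * confRate σ uc θc ((cellCount ℓ z y : ℝ) / (((N : ℝ) + 1) * ℓ ^ 3)) +
          cellKin uc θc ℓ z y ∧
      0 ≤ cellKin uc θc ℓ z y) := by
  obtain ⟨η₀, hη₀, F, hFa, hF, -, -⟩ := eos_data
  refine ⟨min 1 η₀, lt_min one_pos hη₀, ?_⟩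
  intro σ hσ hσ₁ uc θc hθc
  have hσ1 : σ < 1 := lt_of_lt_of_le hσ₁ (min_le_left _ _)
  have hση : σ < η₀ := lt_of_lt_of_le hσ₁ (min_le_right _ _)
  have hx : σ ^ 3 < η₀ := lt_of_le_of_lt (pow_le_of_le_one hσ.le hσ1.le three_ne_zero) hση
  have hx1 : (1 : ℝ) * σ ^ 3 < η₀ := by rwa [one_mul]
  refine ⟨fun r hr => confRate_eq hFa hF hσ hx uc hθc hr,
    fun hH r hr hrσ => confRate_nonneg hFa hF hH hσ hσ1 hx uc hθc hr hrσ, ?_⟩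
  intro N ℓ hℓ z y hij
  obtain ⟨i, hi, j, hj, hvij⟩ := hij
  have hcard : 1 < cellCount ℓ z y := Finset.one_lt_card.2 ⟨i, hi, j, hj, ne_of_apply_ne (fun k => (z k).2) hvij⟩
  have hn : (0 : ℝ) < (cellCount ℓ z y : ℝ) := by exact_mod_cast lt_trans zero_lt_one hcard
  have hpos : ∀ k ∈ cellSet ℓ z y, 0 < boxKernel ℓ ((z k).1 - y) := fun k hk => by
    have hk' : inCube ℓ ((z k).1 - y) := by
      simp only [cellSet, Finset.mem_filter, Finset.mem_univ, true_and] at hk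
      exact hk
    rw [JensenPoint.boxKernel_apply, if_pos hk']
    positivity
  have hθ := Clausius.stateTemp_bU_pos (JensenPoint.boxKernel_nonneg hℓ) z y (hpos i hi) (hpos j hj) hvij
  have hApos : (0 : ℝ) < ((N : ℝ) + 1) * ℓ ^ 3 := by positivity
  set n : ℝ := (cellCount ℓ z y : ℝ) with hn_def
  set M : V3 := ∑ i ∈ cellSet ℓ z y, (z i).2 with hM_def
  set Q : ℝ := ∑ i ∈ cellSet ℓ z y, ‖(z i).2‖ ^ 2 with hQ_def
  set A : ℝ := ((N : ℝ) + 1) * ℓ ^ 3 with hA_def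
  have hbU : bU (boxKernel ℓ) z y = stateOf (n / A) (n⁻¹ • M) ((Q - ‖M‖ ^ 2 / n) / (3 * n)) :=
    bU_boxKernel_eq_stateOf ℓ z y hℓ.ne' hn.ne'
  have hρ : 0 < n / A := div_pos hn hApos
  rw [hbU, stateTemp_stateOf hρ.ne'] at hθ
  have hk : cellKin uc θc ℓ z y =
      3 / 2 * n * ((Q - ‖M‖ ^ 2 / n) / (3 * n) / θc - 1 -
          (Real.log ((Q - ‖M‖ ^ 2 / n) / (3 * n)) - Real.log θc)) +
        n * ‖n⁻¹ • M - uc‖ ^ 2 / (2 * θc) :=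
    kin_identity n Q M uc θc hn hθc hθ
  rw [hk]
  refine ⟨?_, kin_nonneg _ hn hθ hθc⟩
  rw [hbU, relEnt_stateOf hFa hF uc hσ one_pos hθc hx1 hρ.ne', confRate_eq hFa hF hσ hx uc hθc hρ.ne',
    Real.log_one]
  simp only [one_mul]
  have hAρ : A * (n / A) = n := by field_simp
  linear_combination (3 / 2 * ((Q - ‖M‖ ^ 2 / n) / (3 * n) / θc - 1 -
      (Real.log ((Q - ‖M‖ ^ 2 / n) / (3 * n)) - Real.log θc)) + ‖n⁻¹ • M - uc‖ ^ 2 / (2 * θc)) * hAρ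

end Barycentric

end Summit.AtomisticToContinuum.HydrodynamicLimit.Theorems.MacroClosureLine

end
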